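import Summits.QuantumFields.BalabanUV.T4Continuum.Support.SubstrateChartSection
import Mathlib.Analysis.Calculus.DiffContOnCl

/-!
# SUBSTRATE — [dict] D-8: THE REAL SLICE OF THE CHART AND THE ONE-VARIABLE DISC THROUGH A CHART POINT (typer RULING (κ5) ∕ LIBRARY W-14 = L-E10,
# l.16816–16817; NE5 owner g35-d `OutputRateComplexSlice` binders `real` ∕ `hslice`, Q-S16 (ii)): `unitaryLev` (the unitary towers = the real slice:
# `invT = adjOf`, the section of record lands in it), the skew-Hermitian splitting `A = skewRe A + I • skewIm A` of a chart coordinate, the affine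
# disc map `sliceArg A r z := skewRe A + (z∕r) • skewIm A` (through `A` at `z = I·r`, skew-Hermitian — hence UNITARY after `expChartT` — on the real
# axis, inside `ball 0 ρ` on the closed unit disc when `‖A‖ < ρ·r∕(1+r)`), and the junction `diffContOnCl_comp_sliceArg`: an analytic family on the
# chart ball becomes `DiffContOnCl ℂ … (ball 0 1)` along the disc, with its bound — instantiated for the covariance species and the Green's bound

Cell `pub-balaban`, SUBSTRATE cell, seat `b2b-balaban-substrate-p1` (gen 3).  Summits-side under the LEAN PLACEMENT RULE.  HONEST FRAMING: rung (B)+1 of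
the FINITE-VOLUME T⁴ programme — NOT infinite volume, NOT a mass gap, NOT Clay; spine PROVED 0∕9; NE5 NOT PRINTED ∕ NOT proved.  LINEAR ALGEBRA + CALCULUS
GLUE BY NAME (`Matrix.l2_opNorm_conjTranspose`, p220490 `expChart_mem_unitaryGroup`, p224186 `chi_expChartT_of_unitary`, p223952 ∕ p224945 explicit balls,
Mathlib `DifferentiableOn.diffContOnCl_ball`); 0 analysis of Bałaban's.  The two substrate letters a consumer feeds into `hslice` for the COVARIANCE ∕ GREEN
species are PROVED finite-dimensional facts (§4); the TERM families ℰ_A ∕ ℰ_B ([Balaban1987RG1] Thm 1 (1.17)–(1.18) KIND) stay DISPLAYED — never substrate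
(θ8).  Typer remarks T-g35d-1∕2 (domain relativisation; which NE2∕NE3 face is read on the real diameters) are the consumer's; this file serves (s1) and (s2)
alike.  HONEST DEPENDENCY (cell line, verbatim): continuum YM on T⁴ ⇐ BetaPertH ∧ nine spine estimates (0/9 proved); BetaPertH ⇐ (D1) ∧ (D4) ∧ CAP+tail;
G-an2-4 gates asym, D1 and NE2/3/4.

WHAT.
* §1 `unitaryLev P o` ∕ `skewLev P o` (+ `towerDataOf_mem_unitaryLev`, `invT_eq_adjOf_of_mem_unitaryLev`, `mem_affRegularAt_of_mem_unitaryLev`,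
  `expChartT_mem_unitaryLev` for skew-Hermitian coordinates; §5 `unitaryLev₂`, `sectionOfRecord_mem_unitaryLev₂`).
* §2 `skewRe`, `skewIm`, `skewRe_add_I_smul_skewIm` (`= A`), `conjTranspose_skewRe ∕ _skewIm` (skew), `norm_apply_le_norm`, `norm_skewRe_le ∕ norm_skewIm_le` (`≤ ‖A‖`).
* §3 `sliceArg`, `sliceArg_I_mul` (`sliceArg A r (I·r) = A`), `conjTranspose_sliceArg_ofReal` ∕ `sliceArg_ofReal_mem_skewLev` (skew on the real axis),
  `norm_I_mul_ofReal`, `norm_sliceArg_le` (`≤ (1 + r⁻¹)·‖A‖` on `‖z‖ ≤ 1`), **`sliceArg_mem_ball`** (`(1 + r⁻¹)·‖A‖ < ρ`, `‖z‖ ≤ 1` ⇒ `∈ ball 0 ρ`; primed form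
  with `‖A‖ < ρ·r∕(1+r)`), `differentiable_sliceArg`; `sliceDisc R⁰ A r z := expChartT P R⁰ (sliceArg A r z)`, `sliceDisc_I_mul`,
  **`sliceDisc_ofReal_mem_unitaryLev`** (unitary `R⁰`: the real diameter lies in the real slice), `chi_sliceDisc`.
* §4 junctions: **`diffContOnCl_comp_sliceArg`**, `norm_comp_sliceArg_le`, and the packaged **`hslice_sliceDisc`** (typer W14d3: `∃ γ z₀, ‖z₀‖ ≤ r ∧ γ z₀ = u ∧
  real diameter ∧ DiffContOnCl ∧ closed-disc bound`); instances **`diffContOnCl_covAtTLev_sliceDisc`** (every entry of the level-lettered covariance species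
  along the disc, from p223952 `analyticOnNhd_covAtTLev_printed_on_ballExplicit`) and **`opNorm_greenT_sliceDisc_le`** (`≤ 4∕γ` on the closed disc, every level).
Statements = typer sketch v0.8 W14a–d (names kept: `unitaryLev`, `skewLev`, `skewRe`, `skewIm`, `sliceArg`, `sliceDisc`; smallness in the `(1 + r⁻¹)·‖A‖ < ρ` form).
-/

noncomputable section

open scoped BigOperators ComplexConjugate Matrix Matrix.Norms.L2Operator Kronecker ComplexOrder
open Complex (I)

namespace Summit.QuantumFields.BalabanUV.T4Continuum.SubstrateChartRealSlice

open Literature.MathematicalPhysics.QuantumFieldTheory.Balaban1983to89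
open Literature.MathematicalPhysics.QuantumFieldTheory.Balaban1983to89.B5Prop11Plancherel (Tor fine)
open Literature.MathematicalPhysics.QuantumFieldTheory.Balaban1983to89.B5G183RateUnitTower (lev lev_neZero)
open Summit.QuantumFields.BalabanUV.T4Continuum
open Summit.QuantumFields.BalabanUV.T4Continuum.CoerciveInverseTower (Coercive)
open Summit.QuantumFields.BalabanUV.T4Continuum.CovariantVectorCoercive (vecOp)
open Summit.QuantumFields.BalabanUV.T4Continuum.SubstrateBackgroundTransporters (unitMod transV_mem_unitaryGroup)
open Summit.QuantumFields.BalabanUV.T4Continuum.SubstrateTransporterSpecies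
open Summit.QuantumFields.BalabanUV.T4Continuum.SubstrateTransporterSpeciesHolo (expChartT expChartInvT expChartT_apply)
open Summit.QuantumFields.BalabanUV.T4Continuum.SubstrateTransporterSpeciesLev (cPr aPr covAtTLev)
open Summit.QuantumFields.BalabanUV.T4Continuum.SubstrateTransporterSpeciesLevExplicit (rhoLev analyticOnNhd_covAtTLev_printed_on_ballExplicit
  opNorm_greenT_le_on_ballExplicit)
open Summit.QuantumFields.BalabanUV.T4Continuum.SubstrateChartSection (invT chi affRegularAt sectionOfRecord TwoRunChart invT_eq_adjOf_of_unitary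
  mem_affRegularAt_of_unitary chi_expChartT_of_unitary)
open Summit.QuantumFields.BalabanUV.T4Continuum.SubstrateTwoRunsDriven (DrivenRuns)
open Summit.QuantumFields.BalabanUV.T4Continuum.CovariantBlockAveraging (ContourSystem)

variable (P : Params) {o : Type*} [Fintype o] [DecidableEq o]

/-! ## §1 The real slice: unitary towers -/

/-- [folklore] **THE REAL SLICE OF THE CHART** (typer (κ5)(1), the `real` of `OutputRateComplexSlice`): the towers all of whose transporters are unitary. -/
def unitaryLev (o : Type*) [Fintype o] [DecidableEq o] : Set (TowerData P o) := {R | ∀ (k : Fin (P.K + 1)) ν x, R k ν x ∈ Matrix.unitaryGroup o ℂ}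

/-- [folklore] Membership, unfolded. -/
theorem mem_unitaryLev_iff (R : TowerData P o) : R ∈ unitaryLev P o ↔ ∀ (k : Fin (P.K + 1)) ν x, R k ν x ∈ Matrix.unitaryGroup o ℂ := Iff.rfl

/-- [folklore] THE SKEW-HERMITIAN tower data (the real directions of the exponential chart at a unitary centre; typer sketch v0.8 `skewLev`). -/
def skewLev (o : Type*) : Set (TowerData P o) := {A | ∀ (k : Fin (P.K + 1)) ν x, (A k ν x)ᴴ = -A k ν x}

omit [Fintype o] [DecidableEq o] in
/-- [folklore] Membership, unfolded. -/
theorem mem_skewLev_iff (A : TowerData P o) : A ∈ skewLev P o ↔ ∀ (k : Fin (P.K + 1)) ν x, (A k ν x)ᴴ = -A k ν x := Iff.rfl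

/-- [folklore] On the real slice the two-sided reading `chi` IS the real slice of D-8: `invT = adjOf` (p224186). -/
theorem invT_eq_adjOf_of_mem_unitaryLev {R : TowerData P o} (hR : R ∈ unitaryLev P o) : invT P R = fun k => adjOf (R k) :=
  invT_eq_adjOf_of_unitary P hR

variable (cL : ℕ → ℂ) (aL : ℕ → ℝ) (Γ : (k : ℕ) → ContourSystem P.d (lev P.L k) (unitMod P))

/-- [folklore] Unitary towers are affine-regular at level `k` as soon as the real-slice operator `deltaQT … (R k) (adjOf (R k))` is invertible (p224186). -/
theorem mem_affRegularAt_of_mem_unitaryLev {R : TowerData P o} (hR : R ∈ unitaryLev P o) (k : Fin (P.K + 1))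
    (h : IsUnit (deltaQT (lev P.L k) (unitMod P) (cL k) (aL k) (Γ k) (R k) (adjOf (R k))).det) : R ∈ affRegularAt P cL aL Γ k :=
  mem_affRegularAt_of_unitary P cL aL Γ hR k h

section Section

variable {G : Type*} [GaugeGroup G] (ι : G →* Matrix o o ℂ) (av : ∀ j, Averaging P j G)

/-- [folklore] **THE SECTION OF RECORD LANDS IN THE REAL SLICE** (unitary-valued `ι`; `transV_mem_unitaryGroup` — row-side the same fact is
`NE9ChartFaceOperator.towerDataOf_mem_unitaryGroup`). -/
theorem towerDataOf_mem_unitaryLev (hι : ∀ g, ι g ∈ Matrix.unitaryGroup o ℂ) (U : GaugeField P 0 G) : towerDataOf P ι av U ∈ unitaryLev P o :=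
  fun k ν x => transV_mem_unitaryGroup _ hι (Averaging.iter av (P.K - k) U) ν x

end Section

/-- [folklore] Skew-Hermitian chart coordinates at a unitary centre give UNITARY towers (p220490 `expChart_mem_unitaryGroup`, level by level). -/
theorem expChartT_mem_unitaryLev {R₀ : TowerData P o} (hR₀ : R₀ ∈ unitaryLev P o) {A : TowerData P o} (hA : A ∈ skewLev P o) :
    expChartT P R₀ A ∈ unitaryLev P o :=
  fun k ν x => expChart_mem_unitaryGroup (hR₀ k) (hA k) ν x

/-! ## §2 The skew-Hermitian splitting of a chart coordinate -/

/-- [folklore] The skew-Hermitian REAL part of a chart coordinate: `(A − Aᴴ)∕2`, entry by entry. -/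
def skewRe (A : TowerData P o) : TowerData P o := fun k ν x => (1 / 2 : ℂ) • (A k ν x - (A k ν x)ᴴ)

/-- [folklore] The skew-Hermitian IMAGINARY part: `(A + Aᴴ)∕(2I) = (−I∕2)·(A + Aᴴ)`, entry by entry. -/
def skewIm (A : TowerData P o) : TowerData P o := fun k ν x => (-I / 2) • (A k ν x + (A k ν x)ᴴ)

omit [Fintype o] [DecidableEq o] in
/-- [folklore] **THE SPLITTING**: `skewRe A + I • skewIm A = A`. -/
theorem skewRe_add_I_smul_skewIm (A : TowerData P o) : skewRe P A + I • skewIm P A = A := by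
  funext k ν x
  simp only [skewRe, skewIm, Pi.add_apply, Pi.smul_apply, smul_smul]
  rw [show I * (-I / 2) = (1 / 2 : ℂ) by rw [mul_div_assoc', mul_neg, Complex.I_mul_I, neg_neg], smul_sub, smul_add]
  module

omit [Fintype o] [DecidableEq o] in
/-- [folklore] `skewRe A` is skew-Hermitian, entry by entry. -/
theorem conjTranspose_skewRe (A : TowerData P o) (k : Fin (P.K + 1)) (ν : Fin P.d) (x : Tor (fine (lev P.L k) (unitMod P)) × Fin P.d) :
    (skewRe P A k ν x)ᴴ = -(skewRe P A k ν x) := by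
  simp only [skewRe, Matrix.conjTranspose_smul, Matrix.conjTranspose_sub, Matrix.conjTranspose_conjTranspose]
  rw [show star (1 / 2 : ℂ) = 1 / 2 by simp, ← smul_neg, neg_sub]

omit [Fintype o] [DecidableEq o] in
/-- [folklore] `skewIm A` is skew-Hermitian, entry by entry. -/
theorem conjTranspose_skewIm (A : TowerData P o) (k : Fin (P.K + 1)) (ν : Fin P.d) (x : Tor (fine (lev P.L k) (unitMod P)) × Fin P.d) :
    (skewIm P A k ν x)ᴴ = -(skewIm P A k ν x) := by
  simp only [skewIm, Matrix.conjTranspose_smul, Matrix.conjTranspose_add, Matrix.conjTranspose_conjTranspose]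
  rw [show star (-I / 2 : ℂ) = -(-I / 2) by simp [div_eq_mul_inv], neg_smul, add_comm]

omit [Fintype o] [DecidableEq o] in
/-- [folklore] Both parts lie in `skewLev` (typer W14b2). -/
theorem skewRe_mem_skewLev (A : TowerData P o) : skewRe P A ∈ skewLev P o := fun k ν x => conjTranspose_skewRe P A k ν x

omit [Fintype o] [DecidableEq o] in
/-- [folklore] … -/
theorem skewIm_mem_skewLev (A : TowerData P o) : skewIm P A ∈ skewLev P o := fun k ν x => conjTranspose_skewIm P A k ν x

/-- [folklore] Every entry is bounded by the tower norm (Pi-sup): `‖A k ν x‖ ≤ ‖A‖`. -/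
theorem norm_apply_le_norm (A : TowerData P o) (k : Fin (P.K + 1)) (ν : Fin P.d) (x : Tor (fine (lev P.L k) (unitMod P)) × Fin P.d) :
    ‖A k ν x‖ ≤ ‖A‖ :=
  ((norm_le_pi_norm (A k ν) x).trans (norm_le_pi_norm (A k) ν)).trans (norm_le_pi_norm A k)

/-- [folklore] `‖skewRe A‖ ≤ ‖A‖` (`‖Mᴴ‖ = ‖M‖` in the L2-operator norm of record, Q-S13). -/
theorem norm_skewRe_le (A : TowerData P o) : ‖skewRe P A‖ ≤ ‖A‖ := by
  refine (pi_norm_le_iff_of_nonneg (norm_nonneg A)).2 fun k => (pi_norm_le_iff_of_nonneg (norm_nonneg A)).2 fun ν =>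
    (pi_norm_le_iff_of_nonneg (norm_nonneg A)).2 fun x => ?_
  have h1 := norm_apply_le_norm P A k ν x
  calc ‖skewRe P A k ν x‖ = ‖(1 / 2 : ℂ)‖ * ‖A k ν x - (A k ν x)ᴴ‖ := norm_smul _ _
    _ ≤ (1 / 2) * (‖A k ν x‖ + ‖(A k ν x)ᴴ‖) := by
        rw [show ‖(1 / 2 : ℂ)‖ = 1 / 2 by simp]; exact mul_le_mul_of_nonneg_left (norm_sub_le _ _) (by norm_num)
    _ = ‖A k ν x‖ := by rw [Matrix.l2_opNorm_conjTranspose]; ring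
    _ ≤ ‖A‖ := h1

/-- [folklore] `‖skewIm A‖ ≤ ‖A‖`. -/
theorem norm_skewIm_le (A : TowerData P o) : ‖skewIm P A‖ ≤ ‖A‖ := by
  refine (pi_norm_le_iff_of_nonneg (norm_nonneg A)).2 fun k => (pi_norm_le_iff_of_nonneg (norm_nonneg A)).2 fun ν =>
    (pi_norm_le_iff_of_nonneg (norm_nonneg A)).2 fun x => ?_
  have h1 := norm_apply_le_norm P A k ν x
  calc ‖skewIm P A k ν x‖ = ‖(-I / 2 : ℂ)‖ * ‖A k ν x + (A k ν x)ᴴ‖ := norm_smul _ _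
    _ ≤ (1 / 2) * (‖A k ν x‖ + ‖(A k ν x)ᴴ‖) := by
        rw [show ‖(-I / 2 : ℂ)‖ = 1 / 2 by simp]; exact mul_le_mul_of_nonneg_left (norm_add_le _ _) (by norm_num)
    _ = ‖A k ν x‖ := by rw [Matrix.l2_opNorm_conjTranspose]; ring
    _ ≤ ‖A‖ := h1

/-! ## §3 The affine disc map through a chart point and the disc of towers -/

/-- [folklore] **THE AFFINE DISC MAP** `sliceArg A r z := skewRe A + (z∕r) • skewIm A` (`r` = the consumer's depth letter): through `A` at `z = I·r`,
skew-Hermitian on the real axis. -/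
def sliceArg (A : TowerData P o) (r : ℝ) (z : ℂ) : TowerData P o := skewRe P A + (z / r) • skewIm P A

omit [Fintype o] [DecidableEq o] in
/-- [folklore] **THROUGH THE CHART POINT**: `sliceArg A r (I·r) = A` (`r ≠ 0`). -/
theorem sliceArg_I_mul (A : TowerData P o) {r : ℝ} (hr : r ≠ 0) : sliceArg P A r (I * r) = A := by
  rw [sliceArg, mul_div_assoc, div_self (Complex.ofReal_ne_zero.2 hr), mul_one, skewRe_add_I_smul_skewIm]

omit [Fintype o] [DecidableEq o] in
/-- [folklore] **ON THE REAL AXIS THE ARGUMENT IS SKEW-HERMITIAN**, entry by entry. -/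
theorem conjTranspose_sliceArg_ofReal (A : TowerData P o) (r x : ℝ) (k : Fin (P.K + 1)) (ν : Fin P.d)
    (i : Tor (fine (lev P.L k) (unitMod P)) × Fin P.d) : (sliceArg P A r x k ν i)ᴴ = -(sliceArg P A r x k ν i) := by
  simp only [sliceArg, Pi.add_apply, Pi.smul_apply, Matrix.conjTranspose_add, Matrix.conjTranspose_smul, conjTranspose_skewRe, conjTranspose_skewIm,
    ← Complex.ofReal_div, Complex.star_def, Complex.conj_ofReal, smul_neg, neg_add]

omit [Fintype o] [DecidableEq o] in
/-- [folklore] … i.e. the real diameter lies in `skewLev` (typer W14c2, first half). -/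
theorem sliceArg_ofReal_mem_skewLev (A : TowerData P o) (r x : ℝ) : sliceArg P A r x ∈ skewLev P o :=
  fun k ν i => conjTranspose_sliceArg_ofReal P A r x k ν i

omit [Fintype o] [DecidableEq o] in
/-- [folklore] The depth of the base point: `‖I·r‖ = |r|` (the consumer's `z₀ := I·r`). -/
theorem norm_I_mul_ofReal (r : ℝ) : ‖(I * r : ℂ)‖ = |r| := by
  rw [norm_mul, Complex.norm_I, one_mul, Complex.norm_real, Real.norm_eq_abs]

/-- [folklore] `sliceArg` is affine, hence differentiable in `z`. -/
theorem differentiable_sliceArg' (S T : TowerData P o) (r : ℝ) : Differentiable ℂ fun z : ℂ => S + (z / r) • T :=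
  (differentiable_const S).add ((differentiable_id.div_const _).smul_const T)

/-- [folklore] `z ↦ sliceArg A r z` is differentiable (entire, affine). -/
theorem differentiable_sliceArg (A : TowerData P o) (r : ℝ) : Differentiable ℂ fun z : ℂ => sliceArg P A r z :=
  differentiable_sliceArg' P (skewRe P A) (skewIm P A) r

/-- [folklore] **THE NORM ON THE CLOSED UNIT DISC**: `‖z‖ ≤ 1`, `0 < r` ⇒ `‖sliceArg A r z‖ ≤ (1 + r⁻¹)·‖A‖`. -/
theorem norm_sliceArg_le (A : TowerData P o) {r : ℝ} (hr : 0 < r) {z : ℂ} (hz : ‖z‖ ≤ 1) : ‖sliceArg P A r z‖ ≤ (1 + r⁻¹) * ‖A‖ := by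
  have h1 := norm_skewRe_le P A
  have h2 := norm_skewIm_le P A
  have hzr : ‖(z / r : ℂ)‖ ≤ r⁻¹ := by
    rw [norm_div, Complex.norm_real, Real.norm_of_nonneg hr.le, div_eq_mul_inv]
    exact mul_le_of_le_one_left (inv_nonneg.2 hr.le) hz
  calc ‖sliceArg P A r z‖ ≤ ‖skewRe P A‖ + ‖(z / r : ℂ) • skewIm P A‖ := norm_add_le _ _
    _ = ‖skewRe P A‖ + ‖(z / r : ℂ)‖ * ‖skewIm P A‖ := by rw [norm_smul]
    _ ≤ ‖A‖ + r⁻¹ * ‖A‖ := add_le_add h1 (mul_le_mul hzr h2 (norm_nonneg _) (inv_nonneg.2 hr.le))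
    _ = (1 + r⁻¹) * ‖A‖ := by ring

/-- [folklore] **THE DISC STAYS IN THE CHART BALL**: `(1 + r⁻¹)·‖A‖ < ρ`, `0 < r`, `‖z‖ ≤ 1` ⇒ `sliceArg A r z ∈ ball 0 ρ` (typer W14c4). -/
theorem sliceArg_mem_ball (A : TowerData P o) {r ρ : ℝ} (hr : 0 < r) (hA : (1 + r⁻¹) * ‖A‖ < ρ) {z : ℂ} (hz : ‖z‖ ≤ 1) :
    sliceArg P A r z ∈ Metric.ball (0 : TowerData P o) ρ :=
  mem_ball_zero_iff.2 (lt_of_le_of_lt (norm_sliceArg_le P A hr hz) hA)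

omit [Fintype o] [DecidableEq o] in
/-- [folklore] The same smallness in the form `‖A‖ < ρ·r∕(1+r)`. -/
theorem one_add_inv_mul_lt_of_lt {r ρ t : ℝ} (hr : 0 < r) (ht : t < ρ * r / (1 + r)) : (1 + r⁻¹) * t < ρ := by
  have h1r : 0 < 1 + r := by linarith
  have h2 : (1 + r⁻¹) * (ρ * r / (1 + r)) = ρ := by field_simp; ring
  calc (1 + r⁻¹) * t < (1 + r⁻¹) * (ρ * r / (1 + r)) := mul_lt_mul_of_pos_left ht (by positivity)
    _ = ρ := h2

/-- [folklore] … hence `‖A‖ < ρ·r∕(1+r)` ⇒ the disc stays in `ball 0 ρ`. -/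
theorem sliceArg_mem_ball' (A : TowerData P o) {r ρ : ℝ} (hr : 0 < r) (hA : ‖A‖ < ρ * r / (1 + r)) {z : ℂ} (hz : ‖z‖ ≤ 1) :
    sliceArg P A r z ∈ Metric.ball (0 : TowerData P o) ρ :=
  sliceArg_mem_ball P A hr (one_add_inv_mul_lt_of_lt hr hA) hz

/-- [folklore] **THE DISC OF TOWERS** through the chart point `expChartT P R⁰ A`: `sliceDisc R⁰ A r z := expChartT P R⁰ (sliceArg A r z)`. -/
def sliceDisc (R₀ A : TowerData P o) (r : ℝ) (z : ℂ) : TowerData P o := expChartT P R₀ (sliceArg P A r z)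

/-- [folklore] Through the chart point: `sliceDisc R⁰ A r (I·r) = expChartT P R⁰ A`. -/
theorem sliceDisc_I_mul (R₀ A : TowerData P o) {r : ℝ} (hr : r ≠ 0) : sliceDisc P R₀ A r (I * r) = expChartT P R₀ A := by
  rw [sliceDisc, sliceArg_I_mul P A hr]

/-- [folklore] **THE REAL DIAMETER LIES IN THE REAL SLICE**: at a unitary centre, `sliceDisc R⁰ A r x` is a UNITARY tower for every real `x`. -/
theorem sliceDisc_ofReal_mem_unitaryLev {R₀ : TowerData P o} (hR₀ : R₀ ∈ unitaryLev P o) (A : TowerData P o) (r x : ℝ) :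
    sliceDisc P R₀ A r x ∈ unitaryLev P o :=
  expChartT_mem_unitaryLev P hR₀ (sliceArg_ofReal_mem_skewLev P A r x)

/-- [folklore] The two-sided reading along the disc is the exponential pair (unitary centre; p224186 `chi_expChartT_of_unitary`). -/
theorem chi_sliceDisc {R₀ : TowerData P o} (hR₀ : R₀ ∈ unitaryLev P o) (A : TowerData P o) (r : ℝ) (z : ℂ) :
    chi P (sliceDisc P R₀ A r z) = (expChartT P R₀ (sliceArg P A r z), expChartInvT P R₀ (sliceArg P A r z)) :=
  chi_expChartT_of_unitary P hR₀ _

/-! ## §4 Junctions: analytic on the chart ball ⇒ `DiffContOnCl` on the unit disc, with the bound -/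

/-- [folklore] **THE DISC JUNCTION**: a family `F` analytic on the chart ball `ball 0 ρ`, read along the disc map of a coordinate with `‖A‖ < ρ·r∕(1+r)`,
is `DiffContOnCl ℂ … (ball 0 1)` — differentiable on a neighbourhood of the CLOSED unit disc (`sliceArg_mem_ball` + `DifferentiableOn.diffContOnCl_ball`). -/
theorem diffContOnCl_comp_sliceArg {E : Type*} [NormedAddCommGroup E] [NormedSpace ℂ E] {F : TowerData P o → E} {ρ : ℝ}
    (hF : AnalyticOnNhd ℂ F (Metric.ball (0 : TowerData P o) ρ)) (A : TowerData P o) {r : ℝ} (hr : 0 < r) (hA : (1 + r⁻¹) * ‖A‖ < ρ) :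
    DiffContOnCl ℂ (fun z : ℂ => F (sliceArg P A r z)) (Metric.ball (0 : ℂ) 1) := by
  refine DifferentiableOn.diffContOnCl_ball (U := Metric.closedBall (0 : ℂ) 1) (fun z hz => ?_) subset_rfl
  have hmem := sliceArg_mem_ball P A hr hA (mem_closedBall_zero_iff.1 hz)
  exact ((hF _ hmem).differentiableAt.comp z (differentiable_sliceArg P A r z)).differentiableWithinAt

/-- [folklore] … and a bound of `F` on the chart ball transfers to the closed unit disc. -/
theorem norm_comp_sliceArg_le {E : Type*} [NormedAddCommGroup E] {F : TowerData P o → E} {ρ C : ℝ}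
    (hF : ∀ B ∈ Metric.ball (0 : TowerData P o) ρ, ‖F B‖ ≤ C) (A : TowerData P o) {r : ℝ} (hr : 0 < r) (hA : (1 + r⁻¹) * ‖A‖ < ρ) {z : ℂ}
    (hz : ‖z‖ ≤ 1) : ‖F (sliceArg P A r z)‖ ≤ C :=
  hF _ (sliceArg_mem_ball P A hr hA hz)

/-- [folklore] **THE `hslice` PACKAGE** (typer W14d3; what the O1 instance hands to `OutputRateComplexSlice.operatorRate_complex_of_realSlice`,
relativised to the small ball per T-g35d-1): for a unitary centre `R⁰`, `0 < r`, a family `Fg` on GLOBAL chart points whose pull-back along the exponential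
sub-chart is analytic and `C`-bounded on `ball 0 ρ`, and a chart point `expChartT P R⁰ A` with `(1 + r⁻¹)·‖A‖ < ρ`, the disc `γ := sliceDisc R⁰ A r`
witnesses the consumer's five clauses with `z₀ := I·r`. -/
theorem hslice_sliceDisc {E : Type*} [NormedAddCommGroup E] [NormedSpace ℂ E] {R₀ : TowerData P o} (hR₀ : R₀ ∈ unitaryLev P o)
    (Fg : TowerData P o → E) {ρ C r : ℝ} (hr : 0 < r)
    (han : AnalyticOnNhd ℂ (fun A : TowerData P o => Fg (expChartT P R₀ A)) (Metric.ball (0 : TowerData P o) ρ))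
    (hbd : ∀ B ∈ Metric.ball (0 : TowerData P o) ρ, ‖Fg (expChartT P R₀ B)‖ ≤ C) (A : TowerData P o) (hA : (1 + r⁻¹) * ‖A‖ < ρ) :
    ∃ γ : ℂ → TowerData P o, ∃ z₀ : ℂ, ‖z₀‖ ≤ r ∧ γ z₀ = expChartT P R₀ A ∧ (∀ x : ℝ, |x| < 1 → γ x ∈ unitaryLev P o) ∧
      DiffContOnCl ℂ (fun z => Fg (γ z)) (Metric.ball (0 : ℂ) 1) ∧ ∀ z : ℂ, ‖z‖ ≤ 1 → ‖Fg (γ z)‖ ≤ C :=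
  ⟨sliceDisc P R₀ A r, I * r, by rw [norm_I_mul_ofReal, abs_of_pos hr], sliceDisc_I_mul P R₀ A hr.ne',
    fun x _ => sliceDisc_ofReal_mem_unitaryLev P hR₀ A r x,
    diffContOnCl_comp_sliceArg P (F := fun B => Fg (expChartT P R₀ B)) han A hr hA,
    fun _ hz => norm_comp_sliceArg_le P (F := fun B => Fg (expChartT P R₀ B)) hbd A hr hA hz⟩

section Species

variable [Nonempty o] {R₀ : TowerData P o} (hR₀ : ∀ (k : Fin (P.K + 1)) ν i, R₀ k ν i ∈ Matrix.unitaryGroup o ℂ) {a' γ : ℝ} (ha' : 0 ≤ a')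
  (hco : ∀ k : Fin (P.K + 1), Coercive γ (vecOp (lev P.L k) (unitMod P) a' (Γ k) (R₀ k))) (hγ : 0 < γ)
  {ℓ : Fin (P.K + 1) → ℕ} (hΓ : ∀ (k : Fin (P.K + 1)) y j μ (t : Fin (lev P.L k)), (Γ k y j μ t).length ≤ ℓ k)
  (hℓ : ∀ k : Fin (P.K + 1), (ℓ k : ℝ) ≤ ((P.d : ℝ) + 1) * (lev P.L k : ℕ)) (s : ℕ → ℂ)

include hR₀ ha' hco hγ hΓ hℓ in
/-- [folklore] **THE COVARIANCE SPECIES ALONG THE DISC** (the substrate's `hslice` letter for this family): at the printed letters, for a unitary levelwise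
`γ`-coercive centre and a coordinate with `‖A‖ < rhoLev·r∕(1+r)`, every entry of `covAtTLev` read along `sliceDisc R⁰ A r` is `DiffContOnCl ℂ … (ball 0 1)`
(p223952 `analyticOnNhd_covAtTLev_printed_on_ballExplicit` + `diffContOnCl_comp_sliceArg`). -/
theorem diffContOnCl_covAtTLev_sliceDisc (A : TowerData P o) {r : ℝ} (hr : 0 < r) (hA : (1 + r⁻¹) * ‖A‖ < rhoLev P (o := o) γ a') (k : ℕ)
    {T : Type*} (t : T) (b b' : (Tor (unitMod P) × Fin P.d) × o) :
    DiffContOnCl ℂ (fun z : ℂ => covAtTLev P (cPr P) (aPr P a') Γ s (expChartT P R₀ (sliceArg P A r z)) (expChartInvT P R₀ (sliceArg P A r z)) k t b b')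
      (Metric.ball (0 : ℂ) 1) :=
  diffContOnCl_comp_sliceArg P (analyticOnNhd_covAtTLev_printed_on_ballExplicit P Γ hR₀ ha' hco hγ hΓ hℓ s k t b b') A hr hA

include hR₀ ha' hco hγ hΓ hℓ in
/-- [folklore] **THE GREEN's BOUND ON THE CLOSED DISC** (the substrate's bound letter): `‖greenT_k‖ ≤ 4∕γ` along `sliceDisc R⁰ A r` for `‖z‖ ≤ 1`, every level
(p223952 `opNorm_greenT_le_on_ballExplicit` + `sliceArg_mem_ball`). -/
theorem opNorm_greenT_sliceDisc_le (A : TowerData P o) {r : ℝ} (hr : 0 < r) (hA : (1 + r⁻¹) * ‖A‖ < rhoLev P (o := o) γ a') {z : ℂ} (hz : ‖z‖ ≤ 1)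
    (k : Fin (P.K + 1)) :
    ‖greenT (lev P.L k) (unitMod P) (cPr P k) (aPr P a' k) (Γ k) (expChartT P R₀ (sliceArg P A r z) k) (expChartInvT P R₀ (sliceArg P A r z) k)‖ ≤ 4 / γ :=
  opNorm_greenT_le_on_ballExplicit P Γ hR₀ ha' hco hγ hΓ hℓ (sliceArg_mem_ball P A hr hA hz) k

end Species

/-! ## §5 The pair version on the two-run chart -/

section TwoRun

variable {G : Type} [GaugeGroup G] (D : DrivenRuns G) {o' : Type} [Fintype o'] [DecidableEq o'] (ι : G →* Matrix o' o' ℂ)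

/-- [folklore] The real slice of the two-run chart: both factors unitary. -/
def unitaryLev₂ : Set (TwoRunChart D o') := {u | u.1 ∈ unitaryLev (D.F.P D.K) o' ∧ u.2 ∈ unitaryLev (D.F.P (D.K + 1)) o'}

/-- [folklore] **THE SECTION OF RECORD LANDS IN THE REAL SLICE OF THE TWO-RUN CHART** (unitary `ι`). -/
theorem sectionOfRecord_mem_unitaryLev₂ (hι : ∀ g, ι g ∈ Matrix.unitaryGroup o' ℂ) (U : D.carriers.BgB) :
    sectionOfRecord D ι U ∈ unitaryLev₂ D :=
  ⟨towerDataOf_mem_unitaryLev _ ι D.avA hι _, towerDataOf_mem_unitaryLev _ ι D.avB hι _⟩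

end TwoRun

end Summit.QuantumFields.BalabanUV.T4Continuum.SubstrateChartRealSlice

end
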